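import Summits.MatrixMultiplication.MatrixMultiplication.Theorems.AsymptoticRankCWBPerm3Form
import Literature.Computability.AlgebraicComplexity.AsymptoticRankConjecture
import Literature.Barriers.MatrixMultiplication.UnstableTensorBarrier

/-!
# `BThesis` — stub `stub_cwTwo_conciseTight` (line `birth`, crux stmt-MatrixMultiplication-0588):
the little Coppersmith–Winograd tensor `T_cw,2` is concise and tight

Route `MatrixMultiplication/AsymptoticRankCW`, crux `BThesis` = stmt-MatrixMultiplication-0588, line
`Cruxes/BThesis/Lines/birth.lean`, stub `stub_cwTwo_conciseTight : IsConcise (T_cw,2) ∧ IsTight (T_cw,2)`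
with `T_cw,2 = cwTensor ℂ 2 = ∑_{j=1,2} a₀⊗b_j⊗c_j + a_j⊗b₀⊗c_j + a_j⊗b_j⊗c₀ ∈ ℂ³ ⊗ ℂ³ ⊗ ℂ³`.

* CONCISE (`IsConcise`, Bläser–Lysikov §2.2: the three slice families are linearly independent):
  each of the three slice families of `T_cw,2` has the dual coordinates `(1,1)`, `(0,1)`, `(0,2)`
  (slice `0` is the only one with a non-zero entry at `(1,1)`, slice `j ≠ 0` the only one with a
  non-zero entry at `(0,j)`), for all three families at once by the `𝔖₃`-symmetry of `T_cw,2`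
  (`cwTensor_two_linearIndependent_slices₁₂₃`).
* TIGHT (`IsTight`, Conner–Gesmundo–Landsberg–Ventura–Wang 2021 Def. 1.1 = BCS Def. (15.34): tight
  support in SOME bases). The standard support `{(0,j,j),(j,0,j),(j,j,0)}` is not tight, but in the
  CGLV basis `A = !![1,0,0; 0,1,-i; 0,1,i]` (tree: `cglv_exists_basis_cwTensor_two`,
  `(A,A,A)·T_cw,2` has entries `2|ε_{ijk}|`, `det A ≠ 0`, so `A ∈ GL₃(ℂ)` by
  `Matrix.GeneralLinearGroup.mkOfDetNeZero`) the support is contained in the six permutations of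
  `(0,1,2)` (`abs_leviCivita3`), a tight set for the injective labels `τ_A = τ_B = τ_C = (j ↦ j − 1)`:
  `(σ(0)−1) + (σ(1)−1) + (σ(2)−1) = 0` (`isTightSet_pairwise_ne`, then `IsTightSet.mono`).

All sorry-free, standard axioms.

References: A. Conner, F. Gesmundo, J. M. Landsberg, E. Ventura, Y. Wang, Collect. Math. 72 (2021)
= arXiv:1811.05511, Def. 1.1 and p. 5; A. Conner, F. Gesmundo, J. M. Landsberg, E. Ventura, comput.
complexity 31 (2022) = arXiv:1909.04785, §3.2; P. Bürgisser, M. Clausen, M. A. Shokrollahi,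
*Algebraic Complexity Theory* (1997), Def. (15.34); M. Bläser, V. Lysikov, MFCS 2020, §2.2.
-/

set_option linter.dupNamespace false

noncomputable section

namespace Summit.MatrixMultiplication.MatrixMultiplication.Theorems

open Literature.Computability.AlgebraicComplexity
open Literature.Barriers.MatrixMultiplication (IsConcise)

/-! ## Conciseness: the three slice families of `T_cw,2` are linearly independent -/

section Concise

/-- A vanishing combination `∑ᵢ gᵢ · (slice i) = 0` of the slices of `T_cw,2`, read at the dual
coordinates `(1,1)`, `(0,1)`, `(0,2)`, has all coefficients `0`: the common core of the three
linear-independence proofs (the entries of `T_cw,2` at `(i,1,1)`, `(i,0,1)`, `(i,0,2)` are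
`δ_{i0}`, `δ_{i1}`, `δ_{i2}`). [folklore] -/
theorem cwTensor_two_coeff_eq_zero (g : Fin 3 → ℂ)
    (h : ∀ b c : Fin 3, ∑ i : Fin 3, g i * cwTensor ℂ 2 i b c = 0) (i : Fin 3) : g i = 0 := by
  have h11 := h 1 1
  have h01 := h 0 1
  have h02 := h 0 2
  simp only [Fin.sum_univ_three, cwTensor_apply] at h11 h01 h02
  fin_cases i
  · simpa using h11
  · simpa using h01
  · simpa using h02

/-- `T_cw,2` is symmetric in its first two indices. [cite: ConnerGesmundoLandsbergVentura2022, eq. (1)] -/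
theorem cwTensor_two_swap₁₂ (i j k : Fin 3) : cwTensor ℂ 2 j i k = cwTensor ℂ 2 i j k := by
  fin_cases i <;> fin_cases j <;> fin_cases k <;> simp [cwTensor_apply]

/-- `T_cw,2` is symmetric in its first and last indices. [cite: ConnerGesmundoLandsbergVentura2022, eq. (1)] -/
theorem cwTensor_two_swap₁₃ (i j k : Fin 3) : cwTensor ℂ 2 k j i = cwTensor ℂ 2 i j k := by
  fin_cases i <;> fin_cases j <;> fin_cases k <;> simp [cwTensor_apply]

/-- The `a`-slices `(T_cw,2)_{a··}` are linearly independent. [folklore] -/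
theorem cwTensor_two_linearIndependent_slices₁ :
    LinearIndependent ℂ (fun a : Fin 3 => fun p : Fin 3 × Fin 3 => cwTensor ℂ 2 a p.1 p.2) := by
  rw [Fintype.linearIndependent_iff]
  intro g hg
  refine cwTensor_two_coeff_eq_zero g fun b c => ?_
  have := congrFun hg (b, c)
  simpa [Finset.sum_apply, Pi.smul_apply, smul_eq_mul] using this

/-- The `b`-slices `(T_cw,2)_{·b·}` are linearly independent. [folklore] -/
theorem cwTensor_two_linearIndependent_slices₂ :
    LinearIndependent ℂ (fun b : Fin 3 => fun p : Fin 3 × Fin 3 => cwTensor ℂ 2 p.1 b p.2) := by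
  rw [Fintype.linearIndependent_iff]
  intro g hg
  refine cwTensor_two_coeff_eq_zero g fun a c => ?_
  have h : ∑ i, g i * cwTensor ℂ 2 a i c = 0 := by
    simpa [Finset.sum_apply, Pi.smul_apply, smul_eq_mul] using congrFun hg (a, c)
  rw [← h]
  exact Finset.sum_congr rfl fun i _ => by rw [cwTensor_two_swap₁₂]

/-- The `c`-slices `(T_cw,2)_{··c}` are linearly independent. [folklore] -/
theorem cwTensor_two_linearIndependent_slices₃ :
    LinearIndependent ℂ (fun c : Fin 3 => fun p : Fin 3 × Fin 3 => cwTensor ℂ 2 p.1 p.2 c) := by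
  rw [Fintype.linearIndependent_iff]
  intro g hg
  refine cwTensor_two_coeff_eq_zero g fun b c => ?_
  have h : ∑ i, g i * cwTensor ℂ 2 c b i = 0 := by
    simpa [Finset.sum_apply, Pi.smul_apply, smul_eq_mul] using congrFun hg (c, b)
  rw [← h]
  exact Finset.sum_congr rfl fun i _ => by rw [cwTensor_two_swap₁₃]

/-- **`T_cw,2` is concise** (all three flattenings injective). [cite: BlaserLysikov2020, §2.2] -/
theorem isConcise_cwTensor_two : IsConcise (cwTensor ℂ 2) :=
  ⟨cwTensor_two_linearIndependent_slices₁, cwTensor_two_linearIndependent_slices₂,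
    cwTensor_two_linearIndependent_slices₃⟩

end Concise

/-! ## Tightness: the CGLV basis makes the support the six permutations of `(0,1,2)` -/

section Tight

/-- The labels `j ↦ j − 1` on `Fin 3` are injective. [folklore] -/
theorem fin3_intCast_sub_one_injective :
    Function.Injective (fun j : Fin 3 => ((j : ℕ) : ℤ) - 1) := by
  intro i j h
  have h' : ((i : ℕ) : ℤ) = ((j : ℕ) : ℤ) := sub_left_injective h
  exact Fin.ext (by exact_mod_cast h')

/-- The set `{(σ(0),σ(1),σ(2)) : σ ∈ 𝔖₃}` of pairwise-distinct triples in `(Fin 3)³` is tight, for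
`τ_A = τ_B = τ_C = (j ↦ j − 1)`: `(σ(0)−1)+(σ(1)−1)+(σ(2)−1) = 0`.
[cite: ConnerGesmundoLandsbergVenturaWang2020, Def. 1.1] -/
theorem isTightSet_pairwise_ne :
    IsTightSet {p : Fin 3 × Fin 3 × Fin 3 | p.1 ≠ p.2.1 ∧ p.2.1 ≠ p.2.2 ∧ p.1 ≠ p.2.2} := by
  refine ⟨fun j => ((j : ℕ) : ℤ) - 1, fun j => ((j : ℕ) : ℤ) - 1, fun j => ((j : ℕ) : ℤ) - 1,
    fin3_intCast_sub_one_injective, fin3_intCast_sub_one_injective,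
    fin3_intCast_sub_one_injective, ?_⟩
  rintro ⟨i, j, k⟩ h
  simp only [Set.mem_setOf_eq] at h
  obtain ⟨hij, hjk, hik⟩ := h
  fin_cases i <;> fin_cases j <;> fin_cases k <;> simp_all

/-- In the CGLV basis the support of `T_cw,2` lies in the pairwise-distinct triples: the entries of
`(A,A,A)·T_cw,2` are `2|ε_{ijk}|`. [cite: ConnerGesmundoLandsbergVentura2022, §3.2 (proof of Lemma 2.4)] -/
theorem tensorSupport_act_cwTensor_two_subset {A : Matrix (Fin 3) (Fin 3) ℂ}
    (hA : ∀ i j k : Fin 3, ∑ i', ∑ j', ∑ k', A i i' * A j j' * A k k' * cwTensor ℂ 2 i' j' k' =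
      2 * ((|leviCivita3 i j k| : ℤ) : ℂ)) :
    tensorSupport (actTensor A A A (cwTensor ℂ 2)) ⊆
      {p : Fin 3 × Fin 3 × Fin 3 | p.1 ≠ p.2.1 ∧ p.2.1 ≠ p.2.2 ∧ p.1 ≠ p.2.2} := by
  rintro ⟨i, j, k⟩ hp
  simp only [mem_tensorSupport, actTensor_apply, hA, abs_leviCivita3] at hp
  simp only [Set.mem_setOf_eq]
  by_contra h
  exact hp (by rw [if_neg h]; simp)

/-- **`T_cw,2` is tight**: with the CGLV change of basis `A ∈ GL₃(ℂ)` in all three factors the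
support is (contained in) the six permutations of `(0,1,2)`, a tight set.
[cite: ConnerGesmundoLandsbergVenturaWang2020, Def. 1.1] -/
theorem isTight_cwTensor_two : IsTight (cwTensor ℂ 2) := by
  obtain ⟨A, hAdet, hA⟩ := cglv_exists_basis_cwTensor_two
  refine ⟨(Matrix.GeneralLinearGroup.mkOfDetNeZero A hAdet,
    Matrix.GeneralLinearGroup.mkOfDetNeZero A hAdet,
    Matrix.GeneralLinearGroup.mkOfDetNeZero A hAdet), ?_⟩
  simp only [Matrix.GeneralLinearGroup.val_mkOfDetNeZero]
  exact isTightSet_pairwise_ne.mono (tensorSupport_act_cwTensor_two_subset hA)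

end Tight

/-! ## The stub -/

/-- **Stub `stub_cwTwo_conciseTight` of line `birth` (crux stmt-MatrixMultiplication-0588).**
`T_cw,2 ∈ ℂ³ ⊗ ℂ³ ⊗ ℂ³` is concise (all three slice families linearly independent) and tight
(CGLVW Def. 1.1: in the CGLV basis `A = !![1,0,0; 0,1,-i; 0,1,i]` its support is the six
permutations of `(0,1,2)`, tight for `τ_A = τ_B = τ_C = (j ↦ j − 1)`), i.e. `T_cw,2` is an instance
of Strassen's asymptotic rank conjecture at `m = 3`. [cite: ConnerGesmundoLandsbergVenturaWang2020, Def. 1.1] -/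
theorem stub_cwTwo_conciseTight : IsConcise (cwTensor ℂ 2) ∧ IsTight (cwTensor ℂ 2) :=
  ⟨isConcise_cwTensor_two, isTight_cwTensor_two⟩

end Summit.MatrixMultiplication.MatrixMultiplication.Theorems

end
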